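import Summits.QuantumFields.BalabanUV.T4Continuum.Support.VariationalCovariantTower
import Summits.QuantumFields.BalabanUV.T4Continuum.Support.VariationalTaxiCoarseBinders

/-!
# T⁴ programme, spine node NE2 (U1a), lane P2 — A LOCATED FINDING ON THE TOWER END's HYPOTHESES: along a COMP⁺ tower the in-block transport
# defect of UB⁺ CANNOT DECAY — `ŵ_k ≤ w_K + Σ_{k≤j<K} m₁,j` — so the CLASS `n_k·w_k ≤ c_w`, `n_k²·m₁,k ≤ c₁` forces `ŵ_k = O(L^{−2k})`,
# i.e. every in-block holonomy is `≤ perimeter × O(L^{−2k})`: asymptotically FLAT data only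

NE2 formalisation swarm `b2b-balaban-t4-ne2-formalise-*`, leaf 04 GEN 2 (`prover-b2b-balaban-t4-ne2-formalise-leaf-04-g2-0`); found while
trying to instantiate the road owner's END `VariationalCovariantEnd.towerLimitRate_scalarTower_closed` (p213959) at taxi data (my
`VariationalTaxiScalarPair`, p214508).  GAPS row G-ne2leaf04g2-1; journal FINDING line.

THE END's HYPOTHESES (its letters, `fine (L^k) M` = level `k`): COMP⁺ `T (k+1) = compT (L^k) L M (T k) (T′ k)`, `Rc (k+1) = Rtr (L^k) L M (R′ k)`;
ONE⁺'s face binder `hcross k ≤ m₁ k`; UB⁺'s in-block binder `hwin k ≤ w k`; CLASS `L^k·w k ≤ c_w`, `(L^k)²·m₁ k ≤ c₁`.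
THE OBSERVATION (§1, one line of unit-modulus algebra + the tree's block nesting `B5Composition116.bpt_bpt`): for every IN-BLOCK level-`k` bond
`(y, y+e_μ)`, the level-`(k+1)` bond above it leaving the `L`-block `y` through its far `μ`-face has, for the COMPOSITE transport
`T″ = T(block)·T′`, the in-block defect `R′·conj T″(x′+e_μ)·T″(x′) − 1 = [R′conj T′T′ − Rc]·conj T(y+e_μ)T(y) + [Rc·conj T(y+e_μ)·T(y) − 1]`, hence

  `‖Rc_k(y,μ)·conj T_k(y+e_μ)·T_k(y) − 1‖ ≤ m₁,k + w_{k+1}`        (`inBlock_defect_le_of_comp`)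

— THE COARSE IN-BLOCK DEFECT IS BOUNDED BY THE FINE ONE PLUS THE FACE DEFECT.  Iterating up the tower (§2, `inBlock_defect_le_tail`):
`ŵ_k ≤ w_{k+t} + Σ_{i<t} m₁,{k+i}` for every `t`; with the CLASS (§3, `inBlock_defect_le_of_class`, `L ≥ 2`):

  `‖Rc_k(y,μ)·conj T_k(y+e_μ)·T_k(y) − 1‖ ≤ c₁·L²/(L²−1)·(L^k)^{−2}`   for every k and every in-block bond,

i.e. the transports are covariantly constant along every in-block bond to PLAQUETTE accuracy.  §4 (one level, [folklore]): the defects ARE the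
bond phases in the gauge of the site transports (`gaugeR`), plaquettes and rectangles are gauge invariant (`plaq_gaugeR`, `rect_gaugeR`), and
abelian Stokes (`VariationalTaxiCoarse.piT_mul_piT_shift`) in that gauge gives `‖rect − 1‖ ≤ 2(m+ℓ)·w` under a defect bound `w`
(`norm_rect_sub_one_le_perimeter`).
CONSEQUENCE (prose; the kernel content is §1–§4): a physical rectangle of sides `s₁, s₂` inside a unit block has, at level `k`, `m = s₁L^k`,
`ℓ = s₂L^k`, so its holonomy is within `2(s₁+s₂)·c₁L²/(L²−1)·L^{−k}` of `1`; the levels are tied by FED⁺'s `hmis` (coarse bond phase = fine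
straight holonomy conjugated by `T′`, the conjugations telescope around closed loops: `|hol_k − hol_{k+1}| ≤ perimeter·m_k ≤ 2(s₁+s₂)c_m L^{−k}`), so
the holonomy of EVERY in-block physical loop is `1` in the limit: for the intended scale-invariant class (the bond transports of ONE smooth
connection at spacings `L^{−k}`, plaquette defect `a_k ≍ α L^{−2k}`, CLASS `a·n² ≤ c_a` satisfied) the END's hypotheses hold only if the
curvature VANISHES inside every unit block.  Equivalently: Bałaban's composite contour transports (COMP⁺) have in-block defects `ŵ_k ≍ (d−1)·α`
(k-uniform, NOT `O(1/n_k)`), while the level-wise re-based taxi transports of `VariationalTaxiTransport` (`ŵ_k ≤ (d−1)(n_k−1)a_k ≍ dα/n_k`,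
CLASS ✓) violate COMP⁺.  WHAT THIS IS NOT: not a refutation of any tree theorem (the END is a correct conditional), not a claim about NE2;
it LOCATES the remaining analytic content of the variational route WITH background: UB⁺ must be re-proved for composite transports (trial
function with hierarchical phase smoothing across sub-block faces; expected `Λ_k ≲ C_d(1 + (αL)²)`), replacing the datum `n·w ≤ c_w`.

HONEST FRAMING (T4-DAG p. 1).  [folklore] abelian bookkeeping at MODEL level (U(1) phases∕transports DATA); nothing printed is a hypothesis;
no `def … : Prop`; no `sorry`; axioms standard.  NE2 NOT proved (nor disproved); spine 0/9; rung (B)+1 finite T⁴ — NOT infinite volume, NOT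
mass gap, NOT Clay.  HONEST DEPENDENCY (cell, verbatim): continuum YM on T⁴ ⇐ BetaPertH ∧ nine spine estimates (0/9 proved); BetaPertH ⇐
(D1) ∧ (D4) ∧ CAP+tail; G-an2-4 gates asym, D1 and NE2/3/4.
-/

noncomputable section

open scoped BigOperators ComplexConjugate
open Finset

namespace Summit.QuantumFields.BalabanUV.T4Continuum.VariationalTowerDefect

open Literature.MathematicalPhysics.QuantumFieldTheory.Balaban1983to89.B5Prop11Plancherel (Tor fine unitVec)
open Literature.MathematicalPhysics.QuantumFieldTheory.Balaban1983to89.B5Block118 (tstep tstep_zero tstep_succ bpt)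
open Literature.MathematicalPhysics.QuantumFieldTheory.Balaban1983to89.B5Blocks16 (blockOf blockOf_bpt)
open Literature.MathematicalPhysics.QuantumFieldTheory.Balaban1983to89.B5Composition116 (sites bpt_bpt J J_val)
open Summit.QuantumFields.BalabanUV.T4Continuum.ScalarBlockTrialFunction (bpt_add_unitVec_of_eq)
open Summit.QuantumFields.BalabanUV.T4Continuum.VariationalCovariantFederbush (piT)
open Summit.QuantumFields.BalabanUV.T4Continuum.VariationalCovariantUpperBound (mul_conj_of_norm_one)
open Summit.QuantumFields.BalabanUV.T4Continuum.VariationalTower (sites_unitVec)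
open Summit.QuantumFields.BalabanUV.T4Continuum.VariationalCovariantTower (compT Rtr sites_add)
open Summit.QuantumFields.BalabanUV.T4Continuum.VariationalTaxiTransport (plaq norm_plaq norm_prod_sub_one_le norm_prod_eq_one norm_piT)
open Summit.QuantumFields.BalabanUV.T4Continuum.VariationalTaxiCoarse (rect norm_rect piT_mul_piT_shift)
open Summit.QuantumFields.BalabanUV.T4Continuum.VariationalTaxiCoarseBinders (norm_mul_sub_one_le)

variable {d : ℕ}

/-! ## §1 One step: the coarse in-block defect is at most the fine one plus the face defect -/

section OneStep

variable (n L : ℕ) [NeZero n] [NeZero L] (M : Fin d → ℕ) [hM : ∀ μ, NeZero (M μ)]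

/-- **THE COARSE IN-BLOCK DEFECT IS BOUNDED BY THE FINE ONE PLUS THE FACE DEFECT** (COMP⁺ composite transports `compT T T′`, fine phases
`Rtr R′`, unit `T`): for every in-block level-`n` bond, i.e. `y = bpt n M z j` with `j_μ + 1 < n`,
`‖Rc(y,μ)·conj T(y+e_μ)·T(y) − 1‖ ≤ m₁ + w′`, where `m₁` bounds ONE⁺'s face binder `hcross` and `w′` bounds UB⁺'s in-block binder one level UP
(at level `n·L`, for `(Rtr R′, compT T T′)`). [folklore] -/
theorem inBlock_defect_le_of_comp {Rc : Tor (fine n M) → Fin d → ℂ} {T : Tor (fine n M) → ℂ}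
    {R' : Tor (fine L (fine n M)) → Fin d → ℂ} {T' : Tor (fine L (fine n M)) → ℂ}
    (hT1 : ∀ x, ‖T x‖ = 1) {m₁ w' : ℝ}
    (hcross : ∀ (y : Tor (fine n M)) (j : Fin d → Fin L) (μ : Fin d), (j μ : ℕ) + 1 = L →
      ‖R' (bpt L (fine n M) y j) μ * conj (T' (bpt L (fine n M) y j + unitVec (fine L (fine n M)) μ)) * T' (bpt L (fine n M) y j)
        - Rc y μ‖ ≤ m₁)
    (hwin' : ∀ (z : Tor M) (Jx : Fin d → Fin (n * L)) (μ : Fin d), (Jx μ : ℕ) + 1 < n * L →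
      ‖Rtr n L M R' (bpt (n * L) M z Jx) μ * conj (compT n L M T T' (bpt (n * L) M z Jx + unitVec (fine (n * L) M) μ))
        * compT n L M T T' (bpt (n * L) M z Jx) - 1‖ ≤ w')
    (z : Tor M) (j : Fin d → Fin n) (μ : Fin d) (h : (j μ : ℕ) + 1 < n) :
    ‖Rc (bpt n M z j) μ * conj (T (bpt n M z j + unitVec (fine n M) μ)) * T (bpt n M z j) - 1‖ ≤ m₁ + w' := by
  have hL1 : 1 ≤ L := Nat.one_le_iff_ne_zero.mpr (NeZero.ne L)
  have hL0 : 0 < L := hL1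
  -- the far-face offset in direction μ inside the L-block
  set jf : Fin d → Fin L := fun ν => if ν = μ then ⟨L - 1, Nat.sub_lt hL0 one_pos⟩ else 0 with hjf
  have hjfμ : (jf μ : ℕ) + 1 = L := by
    simp only [hjf, if_true]
    exact Nat.sub_add_cancel hL1
  set y : Tor (fine n M) := bpt n M z j with hy
  set x' : Tor (fine L (fine n M)) := bpt L (fine n M) y jf with hx'
  -- the same fine point on the (n·L)-fine torus and its in-block digit
  have hsites : sites n L M (bpt (n * L) M z (J n L j jf)) = x' := by rw [hx', hy, bpt_bpt]
  have hJμ : ((J n L j jf μ : ℕ)) + 1 = L * ((j μ : ℕ) + 1) := by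
    rw [J_val]
    have e : (jf μ : ℕ) + L * (j μ : ℕ) + 1 = ((jf μ : ℕ) + 1) + L * (j μ : ℕ) := by ring
    rw [e, hjfμ]; ring
  have hJ : ((J n L j jf μ : ℕ)) + 1 < n * L := by
    rw [hJμ, Nat.mul_comm n L]
    exact Nat.mul_lt_mul_of_pos_left h hL0
  -- the fine in-block defect of the composite transport above (y, μ)
  have hfine := hwin' z (J n L j jf) μ hJ
  have hse : sites n L M (bpt (n * L) M z (J n L j jf) + unitVec (fine (n * L) M) μ) = x' + unitVec (fine L (fine n M)) μ := by
    rw [sites_add, hsites, sites_unitVec]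
  have hblock0 : blockOf L (fine n M) x' = y := by rw [hx', blockOf_bpt]
  have hblock1 : blockOf L (fine n M) (x' + unitVec (fine L (fine n M)) μ) = y + unitVec (fine n M) μ := by
    rw [hx', bpt_add_unitVec_of_eq L (fine n M) y jf μ hjfμ, blockOf_bpt]
  simp only [Rtr, compT, hsites, hse, hblock0, hblock1] at hfine
  -- the face defect at (y, jf, μ)
  have hface := hcross y jf μ hjfμ
  -- unit-modulus algebra
  set P : ℂ := R' x' μ * conj (T' (x' + unitVec (fine L (fine n M)) μ)) * T' x' with hP
  have hTu : ‖conj (T (y + unitVec (fine n M) μ)) * T y‖ = 1 := by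
    rw [norm_mul, Complex.norm_conj, hT1, hT1, mul_one]
  have e : Rc y μ * conj (T (y + unitVec (fine n M) μ)) * T y - 1
      = (Rc y μ - P) * (conj (T (y + unitVec (fine n M) μ)) * T y)
        + (R' x' μ * conj (T (y + unitVec (fine n M) μ) * T' (x' + unitVec (fine L (fine n M)) μ)) * (T y * T' x') - 1) := by
    simp only [hP, map_mul]; ring
  rw [e]
  refine (norm_add_le _ _).trans (add_le_add ?_ hfine)
  rw [norm_mul, hTu, mul_one, norm_sub_rev]
  exact hface

end OneStep

/-! ## §2 Along the tower: the in-block defect at level `k` is at most `w_{k+t} + Σ_{i<t} m₁,{k+i}` -/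

section Tower

variable (L : ℕ) [NeZero L] (M : Fin d → ℕ) [hM : ∀ μ, NeZero (M μ)]
variable (Rc : (k : ℕ) → Tor (fine (L ^ k) M) → Fin d → ℂ) (T : (k : ℕ) → Tor (fine (L ^ k) M) → ℂ)
variable (R' : (k : ℕ) → Tor (fine L (fine (L ^ k) M)) → Fin d → ℂ) (T' : (k : ℕ) → Tor (fine L (fine (L ^ k) M)) → ℂ)

/-- **THE IN-BLOCK DEFECT CANNOT DECAY ALONG A COMP⁺ TOWER**: in the letters of `VariationalCovariantEnd.towerLimitRate_scalarTower_closed`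
(COMP⁺ `hTcomp`∕`hRtr`, unit `T`, `T′`, ONE⁺'s `hcross k ≤ m₁ k`, UB⁺'s `hwin k ≤ w k`), for every `t` and every in-block level-`k` bond:
`‖Rc_k·conj T_k(·+e_μ)·T_k − 1‖ ≤ w (k+t) + Σ_{i<t} m₁ (k+i)`. [folklore] -/
theorem inBlock_defect_le_tail (hT : ∀ k x, ‖T k x‖ = 1)
    (hTcomp : ∀ k, T (k + 1) = compT (L ^ k) L M (T k) (T' k)) (hRtr : ∀ k, Rc (k + 1) = Rtr (L ^ k) L M (R' k))
    {m₁ w : ℕ → ℝ}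
    (hcross : ∀ k (y : Tor (fine (L ^ k) M)) (j : Fin d → Fin L) (μ : Fin d), (j μ : ℕ) + 1 = L →
      ‖R' k (bpt L (fine (L ^ k) M) y j) μ * conj (T' k (bpt L (fine (L ^ k) M) y j + unitVec (fine L (fine (L ^ k) M)) μ))
          * T' k (bpt L (fine (L ^ k) M) y j) - Rc k y μ‖ ≤ m₁ k)
    (hwin : ∀ k (z : Tor M) (j : Fin d → Fin (L ^ k)) (μ : Fin d), (j μ : ℕ) + 1 < L ^ k →
      ‖Rc k (bpt (L ^ k) M z j) μ * conj (T k (bpt (L ^ k) M z j + unitVec (fine (L ^ k) M) μ)) * T k (bpt (L ^ k) M z j) - 1‖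
        ≤ w k) :
    ∀ (t k : ℕ) (z : Tor M) (j : Fin d → Fin (L ^ k)) (μ : Fin d), (j μ : ℕ) + 1 < L ^ k →
      ‖Rc k (bpt (L ^ k) M z j) μ * conj (T k (bpt (L ^ k) M z j + unitVec (fine (L ^ k) M) μ)) * T k (bpt (L ^ k) M z j) - 1‖
        ≤ w (k + t) + ∑ i ∈ Finset.range t, m₁ (k + i) := by
  intro t
  induction t with
  | zero =>
    intro k z j μ h
    simpa using hwin k z j μ h
  | succ t ih =>
    intro k z j μ h
    -- the in-block bound one level up, in the composite letters
    have hup : ∀ (z' : Tor M) (Jx : Fin d → Fin (L ^ k * L)) (μ' : Fin d), (Jx μ' : ℕ) + 1 < L ^ k * L →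
        ‖Rtr (L ^ k) L M (R' k) (bpt (L ^ k * L) M z' Jx) μ'
            * conj (compT (L ^ k) L M (T k) (T' k) (bpt (L ^ k * L) M z' Jx + unitVec (fine (L ^ k * L) M) μ'))
            * compT (L ^ k) L M (T k) (T' k) (bpt (L ^ k * L) M z' Jx) - 1‖
          ≤ w (k + 1 + t) + ∑ i ∈ Finset.range t, m₁ (k + 1 + i) := by
      intro z' Jx μ' hJ
      have h1 := ih (k + 1) z' Jx μ' hJ
      rw [hTcomp k, hRtr k] at h1
      exact h1
    have hstep := inBlock_defect_le_of_comp (L ^ k) L M (hT k) (hcross k) hup z j μ h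
    refine hstep.trans (le_of_eq ?_)
    rw [Finset.sum_range_succ' (fun i => m₁ (k + i))]
    simp only [← add_assoc, add_zero, Nat.add_right_comm k 1]
    ring

/-! ## §3 With the CLASS: the in-block defect is `O(L^{−2k})` at every level -/

/-- **THE CLASS FORCES PLAQUETTE-ACCURACY COVARIANT CONSTANCY**: with `L ≥ 2`, `L^k·w k ≤ c_w` and `(L^k)²·m₁ k ≤ c₁` (`m₁ ≥ 0`), every in-block
level-`k` transport defect is `≤ c₁·L²/(L²−1)·((L^k)²)⁻¹`. [folklore] -/
theorem inBlock_defect_le_of_class (hL : 2 ≤ L) (hT : ∀ k x, ‖T k x‖ = 1)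
    (hTcomp : ∀ k, T (k + 1) = compT (L ^ k) L M (T k) (T' k)) (hRtr : ∀ k, Rc (k + 1) = Rtr (L ^ k) L M (R' k))
    {m₁ w : ℕ → ℝ} (hm₁ : ∀ k, 0 ≤ m₁ k)
    (hcross : ∀ k (y : Tor (fine (L ^ k) M)) (j : Fin d → Fin L) (μ : Fin d), (j μ : ℕ) + 1 = L →
      ‖R' k (bpt L (fine (L ^ k) M) y j) μ * conj (T' k (bpt L (fine (L ^ k) M) y j + unitVec (fine L (fine (L ^ k) M)) μ))
          * T' k (bpt L (fine (L ^ k) M) y j) - Rc k y μ‖ ≤ m₁ k)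
    (hwin : ∀ k (z : Tor M) (j : Fin d → Fin (L ^ k)) (μ : Fin d), (j μ : ℕ) + 1 < L ^ k →
      ‖Rc k (bpt (L ^ k) M z j) μ * conj (T k (bpt (L ^ k) M z j + unitVec (fine (L ^ k) M) μ)) * T k (bpt (L ^ k) M z j) - 1‖
        ≤ w k)
    {cw c₁ : ℝ} (hwc : ∀ k, (((L ^ k : ℕ)) : ℝ) * w k ≤ cw) (hm₁c : ∀ k, (((L ^ k : ℕ)) : ℝ) ^ 2 * m₁ k ≤ c₁)
    (k : ℕ) (z : Tor M) (j : Fin d → Fin (L ^ k)) (μ : Fin d) (h : (j μ : ℕ) + 1 < L ^ k) :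
    ‖Rc k (bpt (L ^ k) M z j) μ * conj (T k (bpt (L ^ k) M z j + unitVec (fine (L ^ k) M) μ)) * T k (bpt (L ^ k) M z j) - 1‖
      ≤ c₁ * ((L : ℝ) ^ 2 / ((L : ℝ) ^ 2 - 1)) * ((((L ^ k : ℕ)) : ℝ) ^ 2)⁻¹ := by
  have hL1 : (1 : ℝ) < L := by exact_mod_cast (lt_of_lt_of_le one_lt_two hL : 1 < L)
  have hL0 : (0 : ℝ) < L := by linarith
  have hc₁ : 0 ≤ c₁ := by
    have := hm₁c 0
    simp only [pow_zero, Nat.cast_one, one_pow, one_mul] at this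
    exact (hm₁ 0).trans this
  set ρ : ℝ := ((L : ℝ) ^ 2)⁻¹ with hρ
  have hρ0 : 0 ≤ ρ := by positivity
  have hρ1 : ρ < 1 := inv_lt_one_of_one_lt₀ (by nlinarith)
  have hgeo : (1 - ρ)⁻¹ = (L : ℝ) ^ 2 / ((L : ℝ) ^ 2 - 1) := by
    have hL2 : (L : ℝ) ^ 2 ≠ 0 := by positivity
    rw [hρ, inv_eq_one_div ((L : ℝ) ^ 2), one_sub_div hL2, inv_div]
  -- powers of the level
  have hpow : ∀ i : ℕ, ((((L ^ i : ℕ)) : ℝ)) = (L : ℝ) ^ i := fun i => by push_cast; ring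
  have hnk : (0 : ℝ) < (((L ^ k : ℕ)) : ℝ) := by rw [hpow]; positivity
  set D : ℝ := ‖Rc k (bpt (L ^ k) M z j) μ * conj (T k (bpt (L ^ k) M z j + unitVec (fine (L ^ k) M) μ)) * T k (bpt (L ^ k) M z j) - 1‖
    with hD
  -- the tail bound at depth t, in closed form
  have htail : ∀ t : ℕ, D ≤ |cw| * ((L : ℝ)⁻¹) ^ t + c₁ * (1 - ρ)⁻¹ * ((((L ^ k : ℕ)) : ℝ) ^ 2)⁻¹ := by
    intro t
    have h0 := inBlock_defect_le_tail L M Rc T R' T' hT hTcomp hRtr hcross hwin t k z j μ h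
    -- w (k+t) ≤ |cw| / L^(k+t) ≤ |cw| · L^{-t}
    have hw : w (k + t) ≤ |cw| * ((L : ℝ)⁻¹) ^ t := by
      have hn : (0 : ℝ) < (((L ^ (k + t) : ℕ)) : ℝ) := by rw [hpow]; positivity
      have h1 : w (k + t) ≤ cw / (((L ^ (k + t) : ℕ)) : ℝ) := by
        rw [le_div_iff₀ hn, mul_comm]; exact hwc (k + t)
      refine h1.trans ?_
      rw [div_eq_mul_inv]
      refine (mul_le_mul_of_nonneg_right (le_abs_self cw) (inv_nonneg.mpr hn.le)).trans ?_
      refine mul_le_mul_of_nonneg_left ?_ (abs_nonneg cw)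
      rw [hpow, pow_add, mul_inv, inv_pow]
      have h2 : ((L : ℝ) ^ k)⁻¹ ≤ 1 := inv_le_one_of_one_le₀ (one_le_pow₀ hL1.le)
      exact mul_le_of_le_one_left (by positivity) h2
    -- Σ_{i<t} m₁ (k+i) ≤ c₁ (L^k)^{-2} Σ_{i<t} ρ^i ≤ c₁ (L^k)^{-2} (1-ρ)⁻¹
    have hm : ∑ i ∈ Finset.range t, m₁ (k + i) ≤ c₁ * (1 - ρ)⁻¹ * ((((L ^ k : ℕ)) : ℝ) ^ 2)⁻¹ := by
      have hterm : ∀ i ∈ Finset.range t, m₁ (k + i) ≤ c₁ * ((((L ^ k : ℕ)) : ℝ) ^ 2)⁻¹ * ρ ^ i := by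
        intro i _
        have hn : (0 : ℝ) < (((L ^ (k + i) : ℕ)) : ℝ) ^ 2 := by rw [hpow]; positivity
        have h1 : m₁ (k + i) ≤ c₁ / (((L ^ (k + i) : ℕ)) : ℝ) ^ 2 := by
          rw [le_div_iff₀ hn, mul_comm]; exact hm₁c (k + i)
        refine h1.trans (le_of_eq ?_)
        rw [hpow, hpow, hρ, inv_pow, ← pow_mul]
        have hLk : (L : ℝ) ^ k ≠ 0 := by positivity
        have hLki : (L : ℝ) ^ (k + i) ≠ 0 := by positivity
        have hL2 : (L : ℝ) ^ (2 * i) ≠ 0 := by positivity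
        field_simp
        ring
      refine (Finset.sum_le_sum hterm).trans ?_
      rw [← Finset.mul_sum]
      have hg : ∑ i ∈ Finset.range t, ρ ^ i ≤ (1 - ρ)⁻¹ := by
        have h2 : 0 < 1 - ρ := by linarith
        rw [inv_eq_one_div, le_div_iff₀ h2, geom_sum_mul_neg]
        have : 0 ≤ ρ ^ t := pow_nonneg hρ0 t
        linarith
      calc c₁ * ((((L ^ k : ℕ)) : ℝ) ^ 2)⁻¹ * ∑ i ∈ Finset.range t, ρ ^ i
          ≤ c₁ * ((((L ^ k : ℕ)) : ℝ) ^ 2)⁻¹ * (1 - ρ)⁻¹ := mul_le_mul_of_nonneg_left hg (by positivity)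
        _ = _ := by ring
    linarith
  -- let t → ∞
  rw [← hgeo]
  refine le_of_forall_pos_le_add fun ε hε => ?_
  by_cases hcw : cw = 0
  · have := htail 0
    rw [hcw, abs_zero, zero_mul, zero_add] at this
    linarith
  · have hcw' : 0 < |cw| := abs_pos.mpr hcw
    obtain ⟨t, ht⟩ := exists_pow_lt_of_lt_one (div_pos hε hcw') (inv_lt_one_of_one_lt₀ hL1)
    have := htail t
    have h2 : |cw| * ((L : ℝ)⁻¹) ^ t < ε := by
      rw [lt_div_iff₀ hcw'] at ht; linarith [mul_comm ((L : ℝ)⁻¹ ^ t) |cw|]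
    linarith

end Tower

/-! ## §4 One level: `‖rect − 1‖ ≤ perimeter × defect` (the site transports are a gauge; Stokes) -/

section Perimeter

variable (L : ℕ) [NeZero L] (N : Fin d → ℕ) [hN : ∀ μ, NeZero (N μ)]

/-- the bond phases IN THE GAUGE OF THE SITE TRANSPORTS: `R^T(x,μ) := R(x,μ)·conj T(x+e_μ)·T(x)` — the transport defect itself. [folklore] -/
def gaugeR (R : Tor (fine L N) → Fin d → ℂ) (T : Tor (fine L N) → ℂ) : Tor (fine L N) → Fin d → ℂ :=
  fun x μ => R x μ * conj (T (x + unitVec (fine L N) μ)) * T x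

variable {R : Tor (fine L N) → Fin d → ℂ} (hR1 : ∀ x μ, ‖R x μ‖ = 1) {T : Tor (fine L N) → ℂ} (hT1 : ∀ x, ‖T x‖ = 1)
include hR1 hT1

omit [NeZero L] hN in
/-- the gauged phases are unit. [folklore] -/
theorem norm_gaugeR (x : Tor (fine L N)) (μ : Fin d) : ‖gaugeR L N R T x μ‖ = 1 := by
  rw [gaugeR, norm_mul, norm_mul, Complex.norm_conj, hR1, hT1, hT1, mul_one, mul_one]

omit [NeZero L] hN hR1 in
/-- plaquettes are gauge invariant: `plaq (R^T) = plaq R`. [folklore] -/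
theorem plaq_gaugeR (x : Tor (fine L N)) (μ ν : Fin d) : plaq L N (gaugeR L N R T) x μ ν = plaq L N R x μ ν := by
  have hT0 : ∀ y, T y ≠ 0 := fun y h0 => by have := hT1 y; rw [h0, norm_zero] at this; exact zero_ne_one this
  have hinv : ∀ y, conj (T y) = (T y)⁻¹ := fun y => (inv_eq_of_mul_eq_one_right (mul_conj_of_norm_one (hT1 y)).1).symm
  have hc : x + unitVec (fine L N) ν + unitVec (fine L N) μ = x + unitVec (fine L N) μ + unitVec (fine L N) ν := add_right_comm _ _ _
  simp only [plaq, gaugeR, map_mul, hc, hinv, map_inv₀]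
  have h1 := hT0 x
  have h2 := hT0 (x + unitVec (fine L N) μ)
  have h3 := hT0 (x + unitVec (fine L N) ν)
  have h4 := hT0 (x + unitVec (fine L N) μ + unitVec (fine L N) ν)
  field_simp

omit [NeZero L] hN hR1 in
/-- rectangles are gauge invariant. [folklore] -/
theorem rect_gaugeR (p : Tor (fine L N)) (μ : Fin d) (m : ℕ) (ν : Fin d) (ℓ : ℕ) :
    rect L N (gaugeR L N R T) p μ m ν ℓ = rect L N R p μ m ν ℓ := by
  unfold rect
  exact Finset.prod_congr rfl fun s _ => Finset.prod_congr rfl fun t _ => plaq_gaugeR L N hT1 _ _ _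

omit [NeZero L] hN hR1 hT1 in
/-- a straight transport of `r` unit bonds each within `w` of `1` is within `r·w` of `1`. [folklore] -/
theorem norm_piT_sub_one_le {S : Tor (fine L N) → Fin d → ℂ} (hS1 : ∀ x κ, ‖S x κ‖ = 1) {w : ℝ} (hS : ∀ x κ, ‖S x κ - 1‖ ≤ w)
    (q : Tor (fine L N)) (κ : Fin d) (r : ℕ) : ‖piT L N S q κ r - 1‖ ≤ (r : ℝ) * w := by
  induction r with
  | zero => simp [piT]
  | succ r ih =>
    have e : piT L N S q κ (r + 1) - 1 = piT L N S q κ r * (S (q + tstep (fine L N) κ r) κ - 1) + (piT L N S q κ r - 1) := by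
      simp only [piT]; ring
    rw [e]
    refine (norm_add_le _ _).trans ?_
    rw [norm_mul, norm_piT L N hS1, one_mul, Nat.cast_succ]
    have := hS (q + tstep (fine L N) κ r) κ
    linarith

omit [NeZero L] hN in
/-- **HOLONOMY ≤ PERIMETER × DEFECT**: if the transport defect satisfies `‖R(x,κ)·conj T(x+e_κ)·T(x) − 1‖ ≤ w` on the bonds, then every
`m × ℓ` rectangle has `‖rect R p μ m ν ℓ − 1‖ ≤ 2(m + ℓ)·w` — by gauge invariance of the rectangle and Stokes
(`VariationalTaxiCoarse.piT_mul_piT_shift`) in the gauge of the site transports.  With §3's in-block defects this is `perimeter × O(L^{−2k})`,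
against `area × (plaquette defect)` for curved data. [folklore] -/
theorem norm_rect_sub_one_le_perimeter {w : ℝ} (hD : ∀ x κ, ‖R x κ * conj (T (x + unitVec (fine L N) κ)) * T x - 1‖ ≤ w)
    (p : Tor (fine L N)) (μ ν : Fin d) (m ℓ : ℕ) :
    ‖rect L N R p μ m ν ℓ - 1‖ ≤ 2 * ((m : ℝ) + ℓ) * w := by
  have hS1 : ∀ x κ, ‖gaugeR L N R T x κ‖ = 1 := norm_gaugeR L N hR1 hT1
  have hS : ∀ x κ, ‖gaugeR L N R T x κ - 1‖ ≤ w := fun x κ => hD x κ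
  rw [← rect_gaugeR L N hT1 p μ m ν ℓ]
  -- Stokes in the gauge of the site transports
  have hst := piT_mul_piT_shift L N hS1 p μ ν m ℓ
  have nEC : ‖piT L N (gaugeR L N R T) p ν ℓ * piT L N (gaugeR L N R T) (p + tstep (fine L N) ν ℓ) μ m‖ = 1 := by
    rw [norm_mul, norm_piT L N hS1, norm_piT L N hS1, mul_one]
  have u := (mul_conj_of_norm_one nEC).1
  have key : rect L N (gaugeR L N R T) p μ m ν ℓ
      = piT L N (gaugeR L N R T) p μ m * piT L N (gaugeR L N R T) (p + tstep (fine L N) μ m) ν ℓ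
        * conj (piT L N (gaugeR L N R T) p ν ℓ * piT L N (gaugeR L N R T) (p + tstep (fine L N) ν ℓ) μ m) := by
    linear_combination (-(conj (piT L N (gaugeR L N R T) p ν ℓ * piT L N (gaugeR L N R T) (p + tstep (fine L N) ν ℓ) μ m))) * hst
      - rect L N (gaugeR L N R T) p μ m ν ℓ * u
  rw [key]
  have hA := norm_piT_sub_one_le L N hS1 hS p μ m
  have hB := norm_piT_sub_one_le L N hS1 hS (p + tstep (fine L N) μ m) ν ℓ
  have hC := norm_piT_sub_one_le L N hS1 hS (p + tstep (fine L N) ν ℓ) μ m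
  have hE := norm_piT_sub_one_le L N hS1 hS p ν ℓ
  have nA : ‖piT L N (gaugeR L N R T) p μ m‖ = 1 := norm_piT L N hS1 _ _ _
  have nE : ‖piT L N (gaugeR L N R T) p ν ℓ‖ = 1 := norm_piT L N hS1 _ _ _
  have nAB : ‖piT L N (gaugeR L N R T) p μ m * piT L N (gaugeR L N R T) (p + tstep (fine L N) μ m) ν ℓ‖ = 1 := by
    rw [norm_mul, nA, norm_piT L N hS1, mul_one]
  have hconj : ∀ z : ℂ, ‖conj z - 1‖ = ‖z - 1‖ := fun z => by rw [← Complex.norm_conj (z - 1), map_sub, map_one]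
  calc _ ≤ ‖piT L N (gaugeR L N R T) p μ m * piT L N (gaugeR L N R T) (p + tstep (fine L N) μ m) ν ℓ - 1‖
          + ‖conj (piT L N (gaugeR L N R T) p ν ℓ * piT L N (gaugeR L N R T) (p + tstep (fine L N) ν ℓ) μ m) - 1‖ :=
        norm_mul_sub_one_le nAB
    _ ≤ (‖piT L N (gaugeR L N R T) p μ m - 1‖ + ‖piT L N (gaugeR L N R T) (p + tstep (fine L N) μ m) ν ℓ - 1‖)
          + (‖piT L N (gaugeR L N R T) p ν ℓ - 1‖ + ‖piT L N (gaugeR L N R T) (p + tstep (fine L N) ν ℓ) μ m - 1‖) := by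
        rw [hconj]
        exact add_le_add (norm_mul_sub_one_le nA) (norm_mul_sub_one_le nE)
    _ ≤ ((m : ℝ) * w + ℓ * w) + (ℓ * w + m * w) := add_le_add (add_le_add hA hB) (add_le_add hE hC)
    _ = 2 * ((m : ℝ) + ℓ) * w := by ring

end Perimeter

end Summit.QuantumFields.BalabanUV.T4Continuum.VariationalTowerDefect

end
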